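import Summits.KontsevichZagierPeriods.Zeta5Search.SymRayContigTransfer
import Summits.KontsevichZagierPeriods.Zeta5Search.SymRayRecurrenceTransfer
import HarnessLib

/-!
# The partner contiguity of the canonical coefficients on the symmetric ray (cell `pub-zeta5`, P1)

HONEST FRAMING: systematic search; no irrationality claim unless certified.

OUR work (Summit side), P1 seat generation 3. Transfer of `SymRayContigTransfer.contig_identity_ray` to the canonical
coefficients of the wedge dictionary by uniqueness of partial fractions (same mechanism as `SymRayRecurrenceTransfer`):
for `X ∈ {U, W, V}`, `b_m = (3m;m⁷)` and the partner `b'_n = b_n + e₁ = (3n; n+1, n⁶)`,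

  `κ(n)·X(b'_n) = α(n)·X(b_n) + β(n)·X(b_{n+1}) + γ(n)·X(b_{n+2})`   for all `n`   (`ray_contiguity_U/W/V`),

`κ(n) = (2n+1)b₀(n+1) > 0`, `α, β, γ ∈ ℤ[n]` (`symKa, symAl, symBe, symGa`). For `V` the vanishing `y(n,0) = 0` of the
certificate at `t = 0` is used (`Vfun_shiftUp`). In Zudilin's variables (`U = (2/n!⁴)u`, `U' = −(2/n!⁴)ũ`): the coefficient
vectors of `r̃_n` are explicit combinations of three consecutive coefficient vectors of `r_n` — the link between his recursions
(8) and (9) that the identities (15) rest on.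
-/

noncomputable section

open Finset Polynomial

namespace Summit.KontsevichZagierPeriods.Zeta5Search.SymRay

open Summit.KontsevichZagierPeriods.Zeta5Search.DualSeries
open Summit.KontsevichZagierPeriods.Zeta5Search.WedgeDictionary
open Summit.KontsevichZagierPeriods.Zeta5Search.PolyReflect
open Literature.NumberTheory.Transcendental
open Literature.NumberTheory.Transcendental.BallRivoal (pfEval pf_unique poch_pos harm)

/-- `V(bRay' m)` is `Vfun` of the canonical data of the partner. -/
theorem Vfun_ray' (m : ℕ) : Vfun (3 * m) 6 (pfData (bRay' m)) = coeffV (bRay' m) := by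
  rw [coeffV_ray']; rfl

/-- **The combined data of the contiguity identity vanish identically** (uniqueness of partial fractions). -/
theorem contig_data_zero (n : ℕ) : ∃ d : ℕ → ℕ → ℚ,
    (∀ s : ℚ, (∀ p, p ≤ 3 * n + 4 → s + p + 1 ≠ 0) →
      pfEval (3 * n + 4) 7 d s = (hPolyT n).eval s / BallRivoal.poch (s + 1) (3 * n + 5) ^ 7) ∧
    ∀ o p, o < 7 → p ≤ 3 * (n + 2) →
      comb6 (ev1 symKa n) (-ev1 symAl n) (-ev1 symBe n) (-ev1 symGa n)
        (padData (3 * n) (cut (pfData (bRay' n)))) (padData (3 * n) (cut (pfData (bRay n))))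
        (padData (3 * (n + 1)) (cut (pfData (bRay (n + 1))))) (cut (pfData (bRay (n + 2))))
        (padData (3 * n + 4) d) (padData (3 * n + 5) (shiftUp d)) o p = 0 := by
  obtain ⟨d, hd⟩ := exists_pf_H n
  refine ⟨d, hd, fun o p ho hp => data_eq_zero_of_pfEval_zero (3 * (n + 2)) 7 _ (fun t => ?_) ho hp⟩
  rw [pfEval_comb6, pfEval_padData (by omega), pfEval_padData (by omega), pfEval_padData (by omega),
    pfEval_padData (by omega), pfEval_padData (by omega), pfEval_cut, pfEval_cut, pfEval_cut, pfEval_cut,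
    show 3 * n + 5 = (3 * n + 4) + 1 by ring, pfEval_shiftUp]
  have h := contig_identity_ray n t d hd
  linear_combination h

/-- **Partner contiguity for `U`**: `κU(b') = αU(b_n) + βU(b_{n+1}) + γU(b_{n+2})`. -/
theorem ray_contiguity_U (n : ℕ) :
    ev1 symKa n * coeffU (bRay' n) =
      ev1 symAl n * coeffU (bRay n) + ev1 symBe n * coeffU (bRay (n + 1)) + ev1 symGa n * coeffU (bRay (n + 2)) := by
  obtain ⟨d, _, hz⟩ := contig_data_zero n
  have h : ∑ p ∈ range (3 * (n + 2) + 1), comb6 (ev1 symKa n) (-ev1 symAl n) (-ev1 symBe n) (-ev1 symGa n)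
      (padData (3 * n) (cut (pfData (bRay' n)))) (padData (3 * n) (cut (pfData (bRay n))))
      (padData (3 * (n + 1)) (cut (pfData (bRay (n + 1))))) (cut (pfData (bRay (n + 2))))
      (padData (3 * n + 4) d) (padData (3 * n + 5) (shiftUp d)) 4 p = 0 :=
    sum_eq_zero fun p hp => hz 4 p (by norm_num) (Nat.lt_succ_iff.1 (mem_range.1 hp))
  rw [sum_comb6, sum_padData (by omega), sum_padData (by omega), sum_padData (by omega), sum_padData (by omega),
    sum_padData (by omega), sum_cut _ _ (by norm_num), sum_cut _ _ (by norm_num), sum_cut _ _ (by norm_num),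
    sum_cut _ _ (by norm_num), show 3 * n + 5 + 1 = (3 * n + 4) + 2 by ring, sum_shiftUp] at h
  rw [coeffU_ray', coeffU_ray, coeffU_ray, coeffU_ray]
  linear_combination h

/-- **Partner contiguity for `W`.** -/
theorem ray_contiguity_W (n : ℕ) :
    ev1 symKa n * coeffW (bRay' n) =
      ev1 symAl n * coeffW (bRay n) + ev1 symBe n * coeffW (bRay (n + 1)) + ev1 symGa n * coeffW (bRay (n + 2)) := by
  obtain ⟨d, _, hz⟩ := contig_data_zero n
  have h : ∑ p ∈ range (3 * (n + 2) + 1), comb6 (ev1 symKa n) (-ev1 symAl n) (-ev1 symBe n) (-ev1 symGa n)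
      (padData (3 * n) (cut (pfData (bRay' n)))) (padData (3 * n) (cut (pfData (bRay n))))
      (padData (3 * (n + 1)) (cut (pfData (bRay (n + 1))))) (cut (pfData (bRay (n + 2))))
      (padData (3 * n + 4) d) (padData (3 * n + 5) (shiftUp d)) 2 p = 0 :=
    sum_eq_zero fun p hp => hz 2 p (by norm_num) (Nat.lt_succ_iff.1 (mem_range.1 hp))
  rw [sum_comb6, sum_padData (by omega), sum_padData (by omega), sum_padData (by omega), sum_padData (by omega),
    sum_padData (by omega), sum_cut _ _ (by norm_num), sum_cut _ _ (by norm_num), sum_cut _ _ (by norm_num),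
    sum_cut _ _ (by norm_num), show 3 * n + 5 + 1 = (3 * n + 4) + 2 by ring, sum_shiftUp] at h
  rw [coeffW_ray', coeffW_ray, coeffW_ray, coeffW_ray]
  linear_combination h

/-- `H(0) = 0`: the contiguity certificate vanishes at `t = 0`. -/
theorem pfEval_H_zero (n : ℕ) (d : ℕ → ℕ → ℚ)
    (hd : ∀ s : ℚ, (∀ p, p ≤ 3 * n + 4 → s + p + 1 ≠ 0) →
      pfEval (3 * n + 4) 7 d s = (hPolyT n).eval s / BallRivoal.poch (s + 1) (3 * n + 5) ^ 7) :
    pfEval (3 * n + 4) 7 d 0 = 0 := by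
  rw [hd 0 (fun p _ => by positivity), eval_hPolyT, ev2_yCert_zero, zero_mul, zero_div]

/-- **Partner contiguity for the constant term `V`.** -/
theorem ray_contiguity_V (n : ℕ) :
    ev1 symKa n * coeffV (bRay' n) =
      ev1 symAl n * coeffV (bRay n) + ev1 symBe n * coeffV (bRay (n + 1)) + ev1 symGa n * coeffV (bRay (n + 2)) := by
  obtain ⟨d, hd, hz⟩ := contig_data_zero n
  have h := Vfun_eq_zero_of_data (N := 3 * (n + 2)) (K := 7) hz
  rw [Vfun_comb6, Vfun_padData (by omega), Vfun_padData (by omega), Vfun_padData (by omega), Vfun_padData (by omega),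
    Vfun_padData (by omega), Vfun_cut, Vfun_cut, Vfun_cut, Vfun_cut, show 3 * n + 5 = (3 * n + 4) + 1 by ring,
    Vfun_shiftUp, pfEval_H_zero n d hd, Vfun_ray', Vfun_ray, Vfun_ray, Vfun_ray] at h
  linear_combination h

/-- `κ(n) > 0` on the naturals (so the contiguity determines `X(b')`). -/
theorem symKa_pos (n : ℕ) : 0 < ev1 symKa n := by
  simp [symKa]
  positivity

end Summit.KontsevichZagierPeriods.Zeta5Search.SymRay
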